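import Summits.AtomisticToContinuum.HydrodynamicLimit.Theorems.LambertianContactSwapLambertianWellPosedHalfAngle
import HarnessLib

/-!
# The real-valued half-angle law and the `κ_g`-centring identity
# (helpers of the line `Sketch` of the crux `ContactAngleEquidistribution`, stmt-AtomisticToContinuum-12097)

The crux `LambertianContactSwap.ContactAngleEquidistribution` centres every contact-angle mark `ψ(n)` by its
average over the kinematic cosine law `κ_g`, which the route SAMPLES as `ψ(lambertDir(−g) ξ)` with `ξ` standard
Gaussian (`lambertDir ω ξ = normalize(ω̂ + ξ̂)`, `Literature.MathematicalPhysics.KineticTheory.lambertDir`; the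
crux's inline `ldir` is literally this expression).  The tree has the half-angle law for `ℝ≥0∞`-valued
integrands (`HalfAngle.lintegral_lambertDir_stdGaussian`:
`∫⁻ f(lambertDir ν ξ) dγ = π⁻¹ ∫⁻_{S²} ⟪θ, ν⟫₊ f θ dσ`).  Every flux computation for the crux (equilibrium
centring of the isolated functional, the equilibrium case of the near-field balance) needs the REAL-VALUED form
for bounded marks and its corollary, the centring identity: the cosine-flux of a `κ`-centred bounded mark
vanishes.  This file proves both:

* `integral_lambertDir_stdGaussian_real` — `∫ f(lambertDir ν ξ) dγ(ξ) = π⁻¹ ∫_{S²} ⟪θ, ν⟫₊ f θ dσ(θ)` for unit `ν`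
  and bounded measurable real `f` (shift `f + C ≥ 0`, the `ℝ≥0∞` law, and the total flux `π`);
* `integral_cosFlux_sub_avg_eq_zero` — `∫_{S²} ⟪θ, ν⟫₊ (f θ − ∫ f(lambertDir ν ξ) dγ(ξ)) dσ(θ) = 0`;
* `integral_cosFlux_sub_avg_eq_zero_of_ne_zero` — the same about `−ĝ` for any `g ≠ 0`, with the crux's
  un-normalised sampler `lambertDir (−g)` (degree-0 homogeneity `lambertDir_smul_left`).

References: Archimedes' hat-box theorem in flux form (tree: `Literature.Analysis.FluidPDE.lintegral_toSphere_cos`);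
F. Comets, S. Popov, G. M. Schütz, M. Vachkovskaia, ARMA 191 (2008) §2 (cosine reflection law and its sampling).
-/

noncomputable section

open MeasureTheory ProbabilityTheory Set Function Filter Metric
open scoped ENNReal InnerProductSpace Real

namespace Summit.AtomisticToContinuum.HydrodynamicLimit.Theorems.ContactAngleEquidistributionSketch

open Literature.MathematicalPhysics.KineticTheory Literature.Analysis.FluidPDE
open Summit.AtomisticToContinuum.HydrodynamicLimit.Theorems.HalfAngle

/-- The cosine weight `θ ↦ ⟪θ, ν⟫₊` is measurable on the unit sphere. [folklore] -/
theorem measurable_posInner_sphere (ν : V3) :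
    Measurable fun θ : sphere (0 : V3) 1 => max ⟪(θ : V3), ν⟫_ℝ 0 :=
  ((continuous_subtype_val.inner continuous_const).max continuous_const).measurable

/-- The cosine weight is bounded by `1` on the unit sphere (`|⟪θ, ν⟫| ≤ ‖θ‖‖ν‖ = 1`). [folklore] -/
theorem posInner_sphere_le_one {ν : V3} (hν : ‖ν‖ = 1) (θ : sphere (0 : V3) 1) :
    max ⟪(θ : V3), ν⟫_ℝ 0 ≤ 1 := by
  refine max_le ?_ zero_le_one
  have h := real_inner_le_norm (θ : V3) ν
  rw [hν, mul_one, norm_eq_of_mem_sphere θ] at h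
  exact h

/-- **The total cosine flux is `π`** (real-valued form of the hat-box theorem
`lintegral_toSphere_cos`): `∫_{S²} ⟪θ, ν⟫₊ dσ(θ) = π` for unit `ν`. [folklore] -/
theorem integral_posInner_sphere {ν : V3} (hν : ‖ν‖ = 1) :
    ∫ θ : sphere (0 : V3) 1, max ⟪(θ : V3), ν⟫_ℝ 0 ∂(volume.toSphere) = π := by
  have hl : ∫⁻ θ : sphere (0 : V3) 1, ENNReal.ofReal ⟪(θ : V3), ν⟫_ℝ ∂(volume.toSphere) =
      ENNReal.ofReal π := by
    simp_rw [real_inner_comm ν]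
    exact lintegral_toSphere_cos hν
  have hle : ∀ θ : sphere (0 : V3) 1, ENNReal.ofReal ⟪(θ : V3), ν⟫_ℝ =
      ENNReal.ofReal (max ⟪(θ : V3), ν⟫_ℝ 0) := fun θ => by
    rcases le_or_gt 0 ⟪(θ : V3), ν⟫_ℝ with h | h
    · rw [max_eq_left h]
    · rw [max_eq_right h.le, ENNReal.ofReal_zero, ENNReal.ofReal_of_nonpos h.le]
  simp_rw [hle] at hl
  have h0 : 0 ≤ᵐ[volume.toSphere] fun θ : sphere (0 : V3) 1 => max ⟪(θ : V3), ν⟫_ℝ 0 :=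
    Eventually.of_forall fun θ => le_max_right _ _
  rw [integral_eq_lintegral_of_nonneg_ae h0 (measurable_posInner_sphere ν).aestronglyMeasurable, hl,
    ENNReal.toReal_ofReal Real.pi_pos.le]

/-- **The real-valued half-angle law.** For a unit vector `ν` and a bounded measurable real mark `f`,
`∫ f(lambertDir ν ξ) dγ(ξ) = π⁻¹ ∫_{S²} ⟪θ, ν⟫₊ f(θ) dσ(θ)`: the Lambertian direction of a standard Gaussian
vector is cosine-distributed on the hemisphere about `ν`.  From the `ℝ≥0∞` law applied to `f + C ≥ 0` and to
the constant `C`, subtracting (all integrals are finite: `γ` is a probability measure, `σ` is finite, the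
integrands are bounded). [folklore] -/
theorem integral_lambertDir_stdGaussian_real {ν : V3} (hν : ‖ν‖ = 1) {f : V3 → ℝ} (hfm : Measurable f)
    {C : ℝ} (hfb : ∀ x, |f x| ≤ C) :
    ∫ ξ, f (lambertDir ν ξ) ∂(stdGaussian V3) =
      π⁻¹ * ∫ θ : sphere (0 : V3) 1, max ⟪(θ : V3), ν⟫_ℝ 0 * f θ ∂(volume.toSphere) := by
  have hC : 0 ≤ C := (abs_nonneg _).trans (hfb 0)
  have hg0 : ∀ x, 0 ≤ f x + C := fun x => by linarith [neg_abs_le (f x), hfb x]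
  have hgC : ∀ x, f x + C ≤ 2 * C := fun x => by linarith [le_abs_self (f x), hfb x]
  -- the `ℝ≥0∞` law for `f + C`
  have hmeas : Measurable fun x => ENNReal.ofReal (f x + C) :=
    ENNReal.measurable_ofReal.comp (hfm.add_const C)
  have hlaw := lintegral_lambertDir_stdGaussian hν hmeas
  -- left side as a Bochner integral
  have hLm : Measurable fun ξ : V3 => f (lambertDir ν ξ) + C :=
    (hfm.comp (measurable_const.lambertDir measurable_id)).add_const C
  have hLint : Integrable (fun ξ : V3 => f (lambertDir ν ξ) + C) (stdGaussian V3) :=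
    Integrable.of_bound hLm.aestronglyMeasurable (2 * C) (Eventually.of_forall fun ξ => by
      rw [Real.norm_of_nonneg (hg0 _)]; exact hgC _)
  have hL : ∫⁻ ξ, ENNReal.ofReal (f (lambertDir ν ξ) + C) ∂(stdGaussian V3) =
      ENNReal.ofReal (∫ ξ, f (lambertDir ν ξ) + C ∂(stdGaussian V3)) :=
    (ofReal_integral_eq_lintegral_ofReal hLint (Eventually.of_forall fun ξ => hg0 _)).symm
  -- right side as a Bochner integral
  have hw := measurable_posInner_sphere ν
  have hRm : Measurable fun θ : sphere (0 : V3) 1 => max ⟪(θ : V3), ν⟫_ℝ 0 * (f θ + C) :=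
    hw.mul ((hfm.comp continuous_subtype_val.measurable).add_const C)
  have hR0 : ∀ θ : sphere (0 : V3) 1, 0 ≤ max ⟪(θ : V3), ν⟫_ℝ 0 * (f θ + C) :=
    fun θ => mul_nonneg (le_max_right _ _) (hg0 _)
  have hRint : Integrable (fun θ : sphere (0 : V3) 1 => max ⟪(θ : V3), ν⟫_ℝ 0 * (f θ + C))
      (volume.toSphere) :=
    Integrable.of_bound hRm.aestronglyMeasurable (2 * C) (Eventually.of_forall fun θ => by
      rw [Real.norm_of_nonneg (hR0 θ)]
      calc max ⟪(θ : V3), ν⟫_ℝ 0 * (f θ + C) ≤ 1 * (2 * C) :=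
            mul_le_mul (posInner_sphere_le_one hν θ) (hgC _) (hg0 _) zero_le_one
        _ = 2 * C := one_mul _)
  have hprod : ∀ θ : sphere (0 : V3) 1, ENNReal.ofReal ⟪(θ : V3), ν⟫_ℝ * ENNReal.ofReal (f θ + C) =
      ENNReal.ofReal (max ⟪(θ : V3), ν⟫_ℝ 0 * (f θ + C)) := fun θ => by
    have hmax : ENNReal.ofReal ⟪(θ : V3), ν⟫_ℝ = ENNReal.ofReal (max ⟪(θ : V3), ν⟫_ℝ 0) := by
      rcases le_or_gt 0 ⟪(θ : V3), ν⟫_ℝ with h | h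
      · rw [max_eq_left h]
      · rw [max_eq_right h.le, ENNReal.ofReal_zero, ENNReal.ofReal_of_nonpos h.le]
    rw [hmax, ← ENNReal.ofReal_mul (le_max_right _ _)]
  have hR : ∫⁻ θ : sphere (0 : V3) 1, ENNReal.ofReal ⟪(θ : V3), ν⟫_ℝ * ENNReal.ofReal (f θ + C)
      ∂(volume.toSphere) = ENNReal.ofReal (∫ θ : sphere (0 : V3) 1,
        max ⟪(θ : V3), ν⟫_ℝ 0 * (f θ + C) ∂(volume.toSphere)) := by
    simp_rw [hprod]
    exact (ofReal_integral_eq_lintegral_ofReal hRint (Eventually.of_forall hR0)).symm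
  rw [hL, hR, ← ENNReal.ofReal_inv_of_pos Real.pi_pos, ← ENNReal.ofReal_mul (inv_nonneg.2
    Real.pi_pos.le)] at hlaw
  have hreal := (ENNReal.ofReal_eq_ofReal_iff (integral_nonneg fun ξ => hg0 _)
    (mul_nonneg (inv_nonneg.2 Real.pi_pos.le) (integral_nonneg hR0))).1 hlaw
  -- expand both sides
  have hLsplit : ∫ ξ, f (lambertDir ν ξ) + C ∂(stdGaussian V3) =
      (∫ ξ, f (lambertDir ν ξ) ∂(stdGaussian V3)) + C := by
    rw [integral_add _ (integrable_const C), integral_const, probReal_univ, one_smul]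
    exact Integrable.of_bound (hfm.comp (measurable_const.lambertDir measurable_id)).aestronglyMeasurable
      C (Eventually.of_forall fun ξ => by rw [Real.norm_eq_abs]; exact hfb _)
  have hwint : Integrable (fun θ : sphere (0 : V3) 1 => max ⟪(θ : V3), ν⟫_ℝ 0) (volume.toSphere) :=
    Integrable.of_bound hw.aestronglyMeasurable 1 (Eventually.of_forall fun θ => by
      rw [Real.norm_of_nonneg (le_max_right _ _)]; exact posInner_sphere_le_one hν θ)
  have hwfint : Integrable (fun θ : sphere (0 : V3) 1 => max ⟪(θ : V3), ν⟫_ℝ 0 * f θ)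
      (volume.toSphere) :=
    Integrable.of_bound (hw.mul (hfm.comp continuous_subtype_val.measurable)).aestronglyMeasurable
      C (Eventually.of_forall fun θ => by
        rw [norm_mul, Real.norm_of_nonneg (le_max_right _ _), Real.norm_eq_abs]
        calc max ⟪(θ : V3), ν⟫_ℝ 0 * |f θ| ≤ 1 * C :=
              mul_le_mul (posInner_sphere_le_one hν θ) (hfb _) (abs_nonneg _) zero_le_one
          _ = C := one_mul _)
  have hRsplit : ∫ θ : sphere (0 : V3) 1, max ⟪(θ : V3), ν⟫_ℝ 0 * (f θ + C) ∂(volume.toSphere) =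
      (∫ θ : sphere (0 : V3) 1, max ⟪(θ : V3), ν⟫_ℝ 0 * f θ ∂(volume.toSphere)) + C * π := by
    simp_rw [mul_add]
    rw [integral_add hwfint (hwint.mul_const C), integral_mul_const, integral_posInner_sphere hν,
      mul_comm]
  rw [hLsplit, hRsplit, mul_add] at hreal
  have hpi : π⁻¹ * (C * π) = C := by field_simp
  rw [hpi] at hreal
  linarith

/-- **The `κ`-centring identity.** For unit `ν` and a bounded measurable real mark `f`, the cosine flux of
the mark centred by its half-angle (Gaussian-sampled cosine-law) average vanishes:
`∫_{S²} ⟪θ, ν⟫₊ (f θ − ∫ f(lambertDir ν ξ) dγ(ξ)) dσ(θ) = 0`. [folklore] -/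
theorem integral_cosFlux_sub_avg_eq_zero {ν : V3} (hν : ‖ν‖ = 1) {f : V3 → ℝ} (hfm : Measurable f)
    {C : ℝ} (hfb : ∀ x, |f x| ≤ C) :
    ∫ θ : sphere (0 : V3) 1, max ⟪(θ : V3), ν⟫_ℝ 0 *
        (f θ - ∫ ξ, f (lambertDir ν ξ) ∂(stdGaussian V3)) ∂(volume.toSphere) = 0 := by
  have hw := measurable_posInner_sphere ν
  have hwint : Integrable (fun θ : sphere (0 : V3) 1 => max ⟪(θ : V3), ν⟫_ℝ 0) (volume.toSphere) :=
    Integrable.of_bound hw.aestronglyMeasurable 1 (Eventually.of_forall fun θ => by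
      rw [Real.norm_of_nonneg (le_max_right _ _)]; exact posInner_sphere_le_one hν θ)
  have hwfint : Integrable (fun θ : sphere (0 : V3) 1 => max ⟪(θ : V3), ν⟫_ℝ 0 * f θ)
      (volume.toSphere) :=
    Integrable.of_bound (hw.mul (hfm.comp continuous_subtype_val.measurable)).aestronglyMeasurable
      C (Eventually.of_forall fun θ => by
        rw [norm_mul, Real.norm_of_nonneg (le_max_right _ _), Real.norm_eq_abs]
        calc max ⟪(θ : V3), ν⟫_ℝ 0 * |f θ| ≤ 1 * C :=
              mul_le_mul (posInner_sphere_le_one hν θ) (hfb _) (abs_nonneg _) zero_le_one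
          _ = C := one_mul _)
  simp_rw [mul_sub]
  rw [integral_sub hwfint (hwint.mul_const _), integral_mul_const, integral_posInner_sphere hν,
    integral_lambertDir_stdGaussian_real hν hfm hfb]
  field_simp
  ring

/-- **The `κ_g`-centring identity about `−ĝ`, with the crux's un-normalised sampler.** For `g ≠ 0` and a
bounded measurable real mark `f`,
`∫_{S²} ⟪θ, −ĝ⟫₊ (f θ − ∫ f(lambertDir (−g) ξ) dγ(ξ)) dσ(θ) = 0`, `ĝ = ‖g‖⁻¹ g`: the kinematic collision flux
`(−ĝ·n)₊ dn` of an admissible mark centred exactly as in `ContactAngleEquidistribution` vanishes — the cosine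
law `κ_g` is the law of the normal of a collision with uniformly distributed impact parameter
(`lambertDir_smul_left`: the sampler only sees the direction of `−g`). [folklore] -/
theorem integral_cosFlux_sub_avg_eq_zero_of_ne_zero {g : V3} (hg : g ≠ 0) {f : V3 → ℝ}
    (hfm : Measurable f) {C : ℝ} (hfb : ∀ x, |f x| ≤ C) :
    ∫ θ : sphere (0 : V3) 1, max ⟪(θ : V3), -(‖g‖⁻¹ • g)⟫_ℝ 0 *
        (f θ - ∫ ξ, f (lambertDir (-g) ξ) ∂(stdGaussian V3)) ∂(volume.toSphere) = 0 := by
  have hgn : 0 < ‖g‖ := norm_pos_iff.2 hg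
  have hν : ‖-(‖g‖⁻¹ • g)‖ = 1 := by
    rw [norm_neg, norm_smul, Real.norm_of_nonneg (inv_nonneg.2 hgn.le), inv_mul_cancel₀ hgn.ne']
  have hdir : ∀ ξ, lambertDir (-g) ξ = lambertDir (-(‖g‖⁻¹ • g)) ξ := fun ξ => by
    rw [show -(‖g‖⁻¹ • g) = ‖g‖⁻¹ • (-g) from (smul_neg _ _).symm,
      lambertDir_smul_left (inv_pos.2 hgn)]
  simp_rw [hdir]
  exact integral_cosFlux_sub_avg_eq_zero hν hfm hfb

/-- REGISTERED SUB-GOAL `stub_centring` of the line `Sketch` (crux stmt-AtomisticToContinuum-12097; a brick of the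
equilibrium centring `E_G A^V_N → 0`, the first necessary condition of `stub_cost`, and of the equilibrium case of
`stub_nearField`): the `κ_g`-centring identity about `−ĝ` with the crux's un-normalised Gaussian sampler,
`∫_{S²} ⟪θ, −ĝ⟫₊ (f θ − ∫ f(lambertDir (−g) ξ) dγ(ξ)) dσ(θ) = 0` for `g ≠ 0` and bounded measurable `f`. [folklore] -/
theorem stub_centring {g : V3} (hg : g ≠ 0) {f : V3 → ℝ} (hfm : Measurable f) {C : ℝ}
    (hfb : ∀ x, |f x| ≤ C) :
    ∫ θ : sphere (0 : V3) 1, max ⟪(θ : V3), -(‖g‖⁻¹ • g)⟫_ℝ 0 *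
        (f θ - ∫ ξ, f (lambertDir (-g) ξ) ∂(stdGaussian V3)) ∂(volume.toSphere) = 0 :=
  integral_cosFlux_sub_avg_eq_zero_of_ne_zero hg hfm hfb

end Summit.AtomisticToContinuum.HydrodynamicLimit.Theorems.ContactAngleEquidistributionSketch

end
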